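import Mathlib
import Literature.NumberTheory.LFunctions.Zhang2022.Section17Eq178ChiSupport
import HarnessLib

/-!
# Zhang (2022) §17 (17.8): `Φ₃⁻(p) − pΣ_n ((bχ)∗ν₁*)(n)ϱ*(n)/n` — the explicit error bound

Topic `Literature/NumberTheory/LFunctions/Zhang2022` (Landau–Siegel audit tree; verdict-neutral).
Y. Zhang, *Discrete mean estimates and the Landau–Siegel zero*, arXiv:2211.02515v1 (2022)
[Zhang2022LandauSiegel] — **an unrefereed manuscript under adjudication; nothing here asserts or
denies its Theorems 1–2.** §17 p. 98, (17.8): "In a way similar to the proof of (17.3) we deduce that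
`Φ₃⁻(p) = pΣ_n (b∗ν₁*)(n)ϱ*(n)/n + o(p)`" (χ-twisted reading `Typed.Section17.Eq17_8Chi`). Fifth file
of the (17.8)χ discharge: the whole "similar way" as ONE explicit inequality, valid for every modulus
with `𝓛 ≥ 5¹⁰` and every `p ∈ (P, P(1+η))` (no Assumption (A)):

* **`norm_Phi3minus_sub_main_le`** —
  `‖Φ₃⁻(p) − pΣ_n ((bχ)∗ν₁*)(n)ϱ*(n)/n‖ ≤ p·A₀·(Σ_{n≤X}|β|√n)·e^{(1−𝓛₁²)/(4𝓛₂²)}` (term by term)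
  `+ (Σ_{m<3X}|ϱ*_≤|m^{−1/2})(Σ_{n≤X}|β|n^{−1/2}) + A₀(Σ_{n≤X}|β|n^{3/2})·p·(1/3)^{𝓛₂²−2}` (off-diagonal,
  near/far) `+ 2Σ_{n≤X}|ϱ*_≤β|/n` (`#Σ*_{ψ (mod p)} = p − 2`) `+ (p+2)·|Σ_{n≤X} β(ϱ*_≤−ϱ*)/n|` (the
  `l = D⁴` boundary term), where `X = ⌊PT⁻²⌋`, `β = (bχ)∗ν₁*`, `ϱ*_≤ = (ν·[≤D⁴])∗κ̄₂`,
  `A₀ = Σ_m|ϱ*_≤(m)|m^{−3/2}`.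

The sequel turns each term into `o(p)` and closes `Eq17_8Chi`. Theorems only, 0 defs.

## References

* Y. Zhang, arXiv:2211.02515v1 (2022), §17 p. 98 ((17.8)). [cite: Zhang2022LandauSiegel, §17 (17.8) p. 98]
-/
noncomputable section

open Complex Real ComplexConjugate

namespace Literature.NumberTheory.LFunctions.Zhang2022.Phi3Minus

open Literature.NumberTheory.LFunctions.Zhang2022
open Literature.NumberTheory.LFunctions.Zhang2022.Skeleton
open Literature.NumberTheory.LFunctions.Zhang2022.Typed.Section17
open scoped LSeries.notation

variable (c' : ℝ) {D : ℕ} [NeZero D] (χ : DirichletCharacter ℂ D)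

omit [NeZero D] in
/-- Window facts at `𝓛 ≥ 5¹⁰`: `X = ⌊PT⁻²⌋ ≥ 2`, `3X < p`, `X < p`, `2 ≤ 𝓛₂²`, `D ≥ 2`.
[cite: Zhang2022LandauSiegel, §17 (17.8) p.98] -/
theorem window_facts (hℓ : (5 : ℝ) ^ (10 : ℕ) ≤ ell D) {p : ℕ} (hp : p ∈ primeWindow D) :
    2 ≤ ⌊bigP D / bigT D ^ 2⌋₊ ∧ 3 * ⌊bigP D / bigT D ^ 2⌋₊ < p ∧ 2 ≤ ell2 D ^ 2 ∧ 2 ≤ D := by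
  have hℓ1 : 1 ≤ ell D := le_trans (by norm_num) hℓ
  have hℓ2 : 2 ≤ ell D := le_trans (by norm_num) hℓ
  have hℓ0 : 0 < ell D := by linarith
  have hP : 0 < bigP D := Real.exp_pos _
  have hT : 0 < bigT D := Real.exp_pos _
  have hPp : bigP D < p := bigP_lt_of_mem_primeWindow hp
  -- `T² ≥ e² > 3` and `T² ≤ e^{2ℓ²}`
  have hT2 : Real.exp 2 ≤ bigT D ^ 2 := by
    rw [bigT, ← Real.exp_nat_mul, Real.exp_le_exp]
    have : (1 : ℝ) ≤ ell D ^ (1.1 : ℝ) := Real.one_le_rpow hℓ1 (by norm_num)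
    push_cast; linarith
  have h3T : (3 : ℝ) < bigT D ^ 2 := by
    have h1 := Real.exp_one_gt_d9
    have he2 : Real.exp 2 = Real.exp 1 * Real.exp 1 := by rw [← Real.exp_add]; norm_num
    nlinarith
  have hT2le : bigT D ^ 2 ≤ Real.exp (2 * ell D ^ 2) := by
    rw [bigT, ← Real.exp_nat_mul, Real.exp_le_exp]
    have h := Real.rpow_le_rpow_of_exponent_le hℓ1 (show (1.1 : ℝ) ≤ 2 by norm_num)
    rw [Real.rpow_two] at h
    push_cast; linarith
  -- `P/T² ≥ e^{ℓ⁹ − 2ℓ²} ≥ e ≥ 2`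
  have hX2 : (2 : ℝ) ≤ bigP D / bigT D ^ 2 := by
    rw [le_div_iff₀ (by positivity)]
    have h9 : 2 * ell D ^ 2 + 1 ≤ ell D ^ 9 := by
      have h4 : 4 ≤ ell D ^ 2 := by nlinarith
      have : ell D ^ 9 = ell D ^ 2 * ell D ^ 2 * ell D ^ 5 := by ring
      have h5 : 1 ≤ ell D ^ 5 := one_le_pow₀ hℓ1
      nlinarith
    calc 2 * bigT D ^ 2 ≤ Real.exp 1 * Real.exp (2 * ell D ^ 2) := by
          have he : (2 : ℝ) ≤ Real.exp 1 := by have := Real.add_one_le_exp (1 : ℝ); linarith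
          exact mul_le_mul he hT2le (by positivity) (Real.exp_pos _).le
      _ = Real.exp (2 * ell D ^ 2 + 1) := by rw [← Real.exp_add]; ring_nf
      _ ≤ bigP D := by rw [bigP, Real.exp_le_exp]; exact h9
  refine ⟨?_, ?_, ?_, ?_⟩
  · exact Nat.le_floor (by exact_mod_cast hX2)
  · have hfl : (⌊bigP D / bigT D ^ 2⌋₊ : ℝ) ≤ bigP D / bigT D ^ 2 := Nat.floor_le (by positivity)
    have h3 : 3 * (bigP D / bigT D ^ 2) < bigP D := by
      have := div_lt_div_of_pos_left hP (by norm_num : (0 : ℝ) < 3) h3T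
      linarith
    exact_mod_cast (show ((3 * ⌊bigP D / bigT D ^ 2⌋₊ : ℕ) : ℝ) < p by push_cast; linarith)
  · have h400 : 2 ≤ ell D ^ 400 := le_trans hℓ2 (le_self_pow₀ hℓ1 (by norm_num))
    rw [ell2]
    exact le_trans h400 (le_self_pow₀ (one_le_pow₀ hℓ1) (by norm_num))
  · by_contra h
    have hD1 : (D : ℝ) ≤ 1 := by exact_mod_cast (show D ≤ 1 by omega)
    have : ell D ≤ 0 := Real.log_nonpos (Nat.cast_nonneg D) hD1
    linarith

/-- **(17.8), the "similar way" made explicit** (see the module docstring for the shape of the five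
error terms). [cite: Zhang2022LandauSiegel, §17 (17.8) p.98] -/
theorem norm_Phi3minus_sub_main_le (hℓ : (5 : ℝ) ^ (10 : ℕ) ≤ ell D) {p : ℕ} (hp : p ∈ primeWindow D) :
    ‖Phi3minus c' χ p - (p : ℂ) * ∑' n : ℕ,
        ((fun n => bcoef D n * χ (n : ZMod D)) ⍟ nuOneStar c' χ) n * varrho17 c' χ n / (n : ℂ)‖ ≤
      (p : ℝ) * (∑' m : ℕ, ‖LSeries.term (trunc (D ^ 4) (nu χ) ⍟ kappa2bar c' D) (3 / 2 : ℂ) m‖) *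
          (∑ n ∈ Finset.Ico 1 (⌊bigP D / bigT D ^ 2⌋₊ + 1),
            ‖((fun n => bcoef D n * χ (n : ZMod D)) ⍟ nuOneStar c' χ) n‖ * Real.sqrt n) *
          Real.exp ((1 - ell1 D ^ 2) / (4 * ell2 D ^ 2)) +
      ((∑ m ∈ Finset.range (3 * ⌊bigP D / bigT D ^ 2⌋₊),
          ‖(trunc (D ^ 4) (nu χ) ⍟ kappa2bar c' D) m‖ * (m : ℝ) ^ (-(1 / 2 : ℝ))) *
          (∑ n ∈ Finset.Ico 1 (⌊bigP D / bigT D ^ 2⌋₊ + 1),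
            ‖((fun n => bcoef D n * χ (n : ZMod D)) ⍟ nuOneStar c' χ) n‖ * (n : ℝ) ^ (-(1 / 2 : ℝ))) +
        (∑' m : ℕ, ‖LSeries.term (trunc (D ^ 4) (nu χ) ⍟ kappa2bar c' D) (3 / 2 : ℂ) m‖) *
          (∑ n ∈ Finset.Ico 1 (⌊bigP D / bigT D ^ 2⌋₊ + 1),
            ‖((fun n => bcoef D n * χ (n : ZMod D)) ⍟ nuOneStar c' χ) n‖ * (n : ℝ) ^ (3 / 2 : ℝ)) *
          ((1 + ((p : ℝ) - 1)) * (1 / 3 : ℝ) ^ (ell2 D ^ 2 - 2))) +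
      2 * (∑ n ∈ Finset.Ico 1 (⌊bigP D / bigT D ^ 2⌋₊ + 1),
          ‖(trunc (D ^ 4) (nu χ) ⍟ kappa2bar c' D) n‖ *
            ‖((fun n => bcoef D n * χ (n : ZMod D)) ⍟ nuOneStar c' χ) n‖ / n) +
      ((p : ℝ) + 2) * ‖∑ n ∈ Finset.Ico 1 (⌊bigP D / bigT D ^ 2⌋₊ + 1),
          ((fun n => bcoef D n * χ (n : ZMod D)) ⍟ nuOneStar c' χ) n *
            ((trunc (D ^ 4) (nu χ) ⍟ kappa2bar c' D) n - varrho17 c' χ n) / (n : ℂ)‖ := by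
  obtain ⟨hX2, h3X, hL2, hD2⟩ := window_facts hℓ hp
  set X : ℕ := ⌊bigP D / bigT D ^ 2⌋₊ with hXdef
  set S : Finset ℕ := Finset.Ico 1 (X + 1) with hSdef
  set ρ : ℕ → ℂ := trunc (D ^ 4) (nu χ) ⍟ kappa2bar c' D with hρ
  set β : ℕ → ℂ := (fun n => bcoef D n * χ (n : ZMod D)) ⍟ nuOneStar c' χ with hβ
  set Xp : ℕ → ℕ → ℂ := fun m n => ∑ x ∈ chrMod D p, x.ψ (n : ZMod x.p) * conj (x.ψ (m : ZMod x.p))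
    with hXp
  have hp0 : (0 : ℝ) < p := pos_of_mem_primeWindow hp
  have hpr : p.Prime := prime_of_mem_primeWindow' hp
  have hXp_lt : X < p := by omega
  -- support and window bookkeeping
  have hM : ∀ n, X + 1 ≤ n → β n = 0 := by
    intro n hn
    refine bchiConv_eq_zero_of_le c' χ hℓ ?_
    have h1 : bigP D / bigT D ^ 2 < (X : ℝ) + 1 := Nat.lt_floor_add_one _
    have h2 : (X : ℝ) + 1 ≤ n := by exact_mod_cast hn
    linarith
  have hS0 : (0 : ℕ) ∉ S := by simp [hSdef]
  have hS : ∀ n ∈ S, n ≠ 0 ∧ n ≤ X := fun n hn => by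
    rw [hSdef, Finset.mem_Ico] at hn; exact ⟨by omega, by omega⟩
  -- (1) term by term
  have h1 : ‖Phi3minus c' χ p - ∑' m : ℕ, ∑ n ∈ S,
        LSeries.term ρ (SmoothWeight.s0 (-t0 D)) m * (β n * (n : ℂ) ^ (SmoothWeight.s0 (-t0 D) - 1)) *
          cexp (-(ell2 D : ℂ) ^ 2 * (Real.log ((n : ℝ) / m) : ℂ) ^ 2) * Xp m n‖
      ≤ (chrMod D p).card * (∑' m : ℕ, ‖LSeries.term ρ (3 / 2 : ℂ) m‖) *
          (∑ n ∈ S, ‖β n‖ * Real.sqrt n) * Real.exp ((1 - ell1 D ^ 2) / (4 * ell2 D ^ 2)) := by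
    have h := norm_Phi3minus_sub_tsum_le c' χ hD2 p hM
    simpa only [hρ, hβ, hXp, hSdef] using h
  -- (2) off-diagonal
  have hρsum : LSeriesSummable ρ (3 / 2 : ℂ) := by
    obtain ⟨C, -, hC⟩ := exists_norm_varrhoLe_le_rpow
    exact (tsum_norm_term_le_of_rpow (hC c' D χ)).1
  have hX1 : ∀ m n, n ∈ S → m ≠ n → m < p → ‖Xp m n‖ ≤ 1 := fun m n hn hmn hmp =>
    (norm_charSum_le hp m n).2 hmn hmp (by have := (hS n hn).2; omega)
  have hX2' : ∀ m n, n ∈ S → p ≤ m → ‖Xp m n‖ ≤ (p : ℝ) - 1 := fun m n _ _ =>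
    (norm_charSum_le hp m n).1
  have hp1 : (0 : ℝ) ≤ (p : ℝ) - 1 := by
    have : (1 : ℝ) ≤ p := by exact_mod_cast hpr.one_lt.le
    linarith
  obtain ⟨hsum, hoff⟩ := norm_offDiagonal_near_far_le hL2 (-t0 D) hρsum β hS h3X Xp hp1 hX1 hX2'
  -- (3) diagonal
  have hdiag := SmoothWeight.sum_diagonal_eq (L₂ := ell2 D) (-t0 D) ρ β hS0 Xp
    (Xd := ((chrMod D p).card : ℂ)) fun n hn =>
      charSum_diag p (Nat.one_le_iff_ne_zero.mpr (hS n hn).1) (by have := (hS n hn).2; omega)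
  have hsplit := SmoothWeight.tsum_eq_diagonal_add_offDiagonal (-t0 D) ρ β Xp hsum
  rw [hdiag] at hsplit
  set DS : ℂ := ∑' m : ℕ, ∑ n ∈ S,
      LSeries.term ρ (SmoothWeight.s0 (-t0 D)) m * (β n * (n : ℂ) ^ (SmoothWeight.s0 (-t0 D) - 1)) *
        cexp (-(ell2 D : ℂ) ^ 2 * (Real.log ((n : ℝ) / m) : ℂ) ^ 2) * Xp m n with hDS
  set OFF : ℂ := ∑' m : ℕ, ∑ n ∈ S.filter (fun n => n ≠ m),
      LSeries.term ρ (SmoothWeight.s0 (-t0 D)) m * (β n * (n : ℂ) ^ (SmoothWeight.s0 (-t0 D) - 1)) *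
        cexp (-(ell2 D : ℂ) ^ 2 * (Real.log ((n : ℝ) / m) : ℂ) ^ 2) * Xp m n with hOFF
  -- (4) the target sum is the finite sum over `S`
  set Sg : ℂ := ∑ n ∈ S, β n * varrho17 c' χ n / (n : ℂ) with hSg
  set Bd : ℂ := ∑ n ∈ S, β n * (ρ n - varrho17 c' χ n) / (n : ℂ) with hBd
  have htsum : ∑' n : ℕ, β n * varrho17 c' χ n / (n : ℂ) = Sg := by
    rw [hSg, tsum_eq_sum]
    intro n hn
    rcases eq_or_ne n 0 with rfl | h0
    · simp
    · have : X + 1 ≤ n := by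
        by_contra h
        exact hn (by rw [hSdef, Finset.mem_Ico]; omega)
      rw [hM n this, zero_mul, zero_div]
  have hρβ : ∑ n ∈ S, ρ n * β n / (n : ℂ) = Sg + Bd := by
    rw [hSg, hBd, ← Finset.sum_add_distrib]
    refine Finset.sum_congr rfl fun n _ => ?_
    ring
  have hcardC : ((chrMod D p).card : ℂ) = (p : ℂ) - 2 := by
    rw [Phi3TermByTerm.card_chrMod hp]
    push_cast [Nat.cast_sub hpr.two_le]; ring
  -- the algebraic identity
  have hid : Phi3minus c' χ p - (p : ℂ) * Sg =
      (Phi3minus c' χ p - DS) + OFF - 2 * Sg + ((p : ℂ) - 2) * Bd := by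
    rw [hρβ, hcardC] at hsplit
    rw [hsplit]; ring
  rw [htsum, hid]
  -- sizes of the last two pieces
  have hSgBd : ‖(2 : ℂ) * Sg‖ ≤ 2 * (∑ n ∈ S, ‖ρ n‖ * ‖β n‖ / n) + 2 * ‖Bd‖ := by
    rw [norm_mul, Complex.norm_two]
    have hρβn : ‖∑ n ∈ S, ρ n * β n / (n : ℂ)‖ ≤ ∑ n ∈ S, ‖ρ n‖ * ‖β n‖ / n := by
      refine (norm_sum_le _ _).trans (le_of_eq (Finset.sum_congr rfl fun n _ => ?_))
      rw [norm_div, norm_mul, Complex.norm_natCast]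
    have hSg' : ‖Sg‖ ≤ ‖Sg + Bd‖ + ‖Bd‖ := by
      have := norm_sub_le (Sg + Bd) Bd
      rwa [add_sub_cancel_right] at this
    rw [← hρβ] at hSg'
    linarith
  have hpBd : ‖((p : ℂ) - 2) * Bd‖ ≤ (p : ℝ) * ‖Bd‖ := by
    rw [norm_mul]
    refine mul_le_mul_of_nonneg_right ?_ (norm_nonneg _)
    have : ((p : ℂ) - 2) = (((p : ℝ) - 2 : ℝ) : ℂ) := by push_cast; ring
    rw [this, Complex.norm_real, Real.norm_eq_abs, abs_le]
    have : (2 : ℝ) ≤ p := by exact_mod_cast hpr.two_le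
    constructor <;> linarith
  have hcard_le : ((chrMod D p).card : ℝ) ≤ p := by
    rw [Phi3TermByTerm.card_chrMod hp]; exact_mod_cast Nat.sub_le p 2
  -- (1') bound the term-by-term error's `#Σ*` by `p`
  have h1' : ‖Phi3minus c' χ p - DS‖ ≤
      (p : ℝ) * (∑' m : ℕ, ‖LSeries.term ρ (3 / 2 : ℂ) m‖) * (∑ n ∈ S, ‖β n‖ * Real.sqrt n) *
        Real.exp ((1 - ell1 D ^ 2) / (4 * ell2 D ^ 2)) := by
    refine h1.trans ?_
    have hA0 : 0 ≤ ∑' m : ℕ, ‖LSeries.term ρ (3 / 2 : ℂ) m‖ := tsum_nonneg fun _ => norm_nonneg _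
    have hB0 : 0 ≤ ∑ n ∈ S, ‖β n‖ * Real.sqrt n := Finset.sum_nonneg fun _ _ => by positivity
    gcongr
  have e1 : ‖(Phi3minus c' χ p - DS) + OFF - 2 * Sg + ((p : ℂ) - 2) * Bd‖ ≤
      ‖(Phi3minus c' χ p - DS) + OFF - 2 * Sg‖ + ‖((p : ℂ) - 2) * Bd‖ := norm_add_le _ _
  have e2 : ‖(Phi3minus c' χ p - DS) + OFF - 2 * Sg‖ ≤
      ‖(Phi3minus c' χ p - DS) + OFF‖ + ‖(2 : ℂ) * Sg‖ := norm_sub_le _ _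
  have e3 : ‖(Phi3minus c' χ p - DS) + OFF‖ ≤ ‖Phi3minus c' χ p - DS‖ + ‖OFF‖ := norm_add_le _ _
  linarith [e1, e2, e3, h1', hoff, hSgBd, hpBd]

end Literature.NumberTheory.LFunctions.Zhang2022.Phi3Minus
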